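import Summits.QuantumFields.YangMills.Theorems.BalabanUVNodesN15NeumannCubePairing
import HarnessLib

/-!
# Route «BalabanUVNodes» (K3⁷), node N15 = NE2, -a lane, PROGRAMME N file N-IIb: THE SEAM BONDS AND THE EXACT η-DEFECT IDENTITY OF THE CUBE-LOCALIZED NEUMANN PROPAGATORS

Cell `pub-ymgap`, seat `pub-ymgap-dag-n15-a` (KNIT-BY-NAME, g19; D-0062; chair R424 venue; `bears_on: R4∕N15`); `--kind proof --supports stmt-QuantumFields-20544 --as helper`.
Sequel of N-IIa `…N15NeumannCubePairing`.  CONSUMER: dag-n15-c FILE 45 `hasMaj_idef_glued_of_cubes` (`hDG`), through file N-IIc `…N15NeumannCubeDefect`.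

WHAT.  §14 ★★ `symOp_comp_mulOp_chiInt`: `Sym ∘ M_{χ°} = Sym ∘ M_{χ_□}` — where the interior indicator `χ°` (N-IIIa `intBonds`) and the indicator `χ_□` of King's unit blocks of the
cube (N-IIIb `chiCube`) differ, the bond is a SEAM bond (starts in the cube, on the upper mirror of its own direction: `seam_of_chiCube_ne_chiInt`), and seam bonds are their own
mirror images (`imgBond_symmDiff_of_seam`, an identity in `ℤ∕(2Sn)`: `two_mul_natCast_pred_add_two`) entering the symmetriser with both signs (`sgnT_symmDiff`; a fixed-point-free
involution `T ↦ T △ {μ}` on the `2^{d+1}` images); hence ★★ `neumannCubeG_eq_chiCube`: `G(□ + c) = Sym ∘ G ∘ M_{χ_□}` — the source cut is read on unit blocks, COMPATIBLE with the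
pairing of two spacings (`chiCube_kingPrV`, `pull_kingPrV_comp_mulOp_chiCube`, `idef_mulOp_chiCube = 0`).  §15 ★★★ `idef_chiCube_neumannCubeG`:
`𝔇(G′_□, G_□) = M_{χ′_□} ∘ Sym′ ∘ 𝔇(G′, G) ∘ M_{χ_□} + Σ_T M_{mask_T} ∘ P ∘ (M_{χ_□} ∘ R_T ∘ (D ∘ G ∘ M_{χ_□}))` EXACTLY — the TORUS two-grid defect dressed by the images plus `2^{d+1}`
face terms, each carrying one own-direction COARSE difference of `G` (Leibniz for `𝔇` over `M_χ ∘ Sym ∘ G ∘ M_χ`, N-IIa's `𝔇(Sym′, Sym)`).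
HONEST FRAMING.  Finite lattice algebra; no estimate; nothing of [B6]∕[B9] asserted; N15 NOT discharged (object-bound; NE2⁺ NOT PRINTED); counts UNMOVED (typed 28∕28 · discharged
5∕27); one finite torus pair — NOT continuum ∕ ℝ⁴ ∕ OS ∕ mass gap ∕ Clay.  Theorems only (0 `def`).
-/

noncomputable section

open scoped BigOperators Matrix
open Finset

namespace Summit.QuantumFields.YangMills.BalabanUVNodes.N15.TwoGrid

open Literature.MathematicalPhysics.QuantumFieldTheory.Balaban1983to89
open Literature.MathematicalPhysics.QuantumFieldTheory.Balaban1983to89.B5Prop11Plancherel (Tor fine unitVec)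
open Literature.MathematicalPhysics.QuantumFieldTheory.Balaban1983to89.B5Block118 (up bpt upHom upHom_intCast)
open Literature.MathematicalPhysics.QuantumFieldTheory.Balaban1983to89.B6Prop26Gluing (mulOp mulOp_apply ind ind_nonneg ind_le_one)
open Literature.MathematicalPhysics.QuantumFieldTheory.King1986.Torus (blockOf tdistT)
open Literature.MathematicalPhysics.QuantumFieldTheory.Balaban1983to89.B11SectG (BlockNorm HasMaj)
open Literature.MathematicalPhysics.QuantumFieldTheory.Balaban1983to89.B6UnitTorusCarrier (unitTorusGeo)
open Literature.MathematicalPhysics.QuantumFieldTheory.Balaban1983to89.B5SiteBridgeP12 (MP)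
open Literature.MathematicalPhysics.QuantumFieldTheory.Balaban1983to89.T4EtaRateDefect (idef idef_comp)
open Literature.MathematicalPhysics.QuantumFieldTheory.Balaban1983to89.T4EtaRateCoeffDefect (pull pull_apply)
open Summit.QuantumFields.YangMills.BalabanUVNodes.N15.VectorPiece (blkFine kingPr kingPrV kingPr_val kingPr_add_unitVec blkFine_comp_kingPrV)

variable {d : ℕ}

/-! ## §14 THE SOURCE MASK MAY BE THE WHOLE CUBE: `Sym ∘ χ° = Sym ∘ χ_□` (the seam bonds are their own mirror images, with opposite signs) -/

section Seam

variable {M : Fin (d + 1) → ℕ} [∀ μ, NeZero (M μ)] {n : ℕ} [NeZero n] {c : Tor M} {S : ℕ}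

/-- a bond starting in a block of the cube starts in the cube's `Sn`-window. [folklore] -/
theorem val_sub_up_lt_of_blockOf_mem {x : Tor (fine n M)} (h : blockOf n M x ∈ cubeBlocks M c S) (ν : Fin (d + 1)) : (x ν - up n M c ν).val < S * n := by
  have hν := (mem_cubeBlocks _).mp h ν
  obtain ⟨a, hx⟩ := exists_eq_bpt_blockOf M n x
  have hsub : x - up n M c = bpt n M (blockOf n M x - c) a := by
    have up_neg : up n M (-c) = -up n M c := by funext ν; simp [up]
    rw [sub_eq_add_neg, ← up_neg, sub_eq_add_neg, bpt_add, ← hx]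
  have hval : (x ν - up n M c ν) = (x - up n M c) ν := rfl
  rw [hval, hsub, B5Blocks16.bpt_val]
  have ha : (a ν : ℕ) < n := (a ν).isLt
  calc n * ((blockOf n M x - c) ν).val + (a ν : ℕ) < n * ((blockOf n M x - c) ν).val + n := by omega
    _ = n * (((blockOf n M x - c) ν).val + 1) := by ring
    _ ≤ n * S := Nat.mul_le_mul_left n hν
    _ = S * n := mul_comm _ _

/-- where `χ_□` and `χ°` differ, the bond is a SEAM bond: it starts in the cube, on the upper mirror of its own direction. [folklore] -/
theorem seam_of_chiCube_ne_chiInt {b : Tor (fine n M) × Fin (d + 1)} (h : chiCube M n c S b ≠ chiInt M n c S b) :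
    (∀ ν, (b.1 ν - up n M c ν).val < S * n) ∧ (b.1 b.2 - up n M c b.2).val = S * n - 1 := by
  by_cases hint : b ∈ intBonds M n c S
  · exact absurd (by rw [chiInt_of_intBond hint, chiCube, if_pos (blockOf_mem_cubeBlocks hint)]) h
  · have hcube : blockOf n M b.1 ∈ cubeBlocks M c S := by
      by_contra hc
      exact h (by rw [chiCube_of_not_mem hc, chiInt_of_not_intBond hint])
    have hwin := val_sub_up_lt_of_blockOf_mem hcube
    refine ⟨hwin, ?_⟩
    by_contra hne
    exact hint ((mem_intBonds b).mpr ⟨hwin, hne⟩)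

omit [∀ μ, NeZero (M μ)] [NeZero n] in
/-- toggling the bond's own direction in `T` flips the sign. [folklore] -/
theorem sgnT_symmDiff (T : Finset (Fin (d + 1))) (b : Tor (fine n M) × Fin (d + 1)) : sgnT M n (symmDiff T {b.2}) b = -sgnT M n T b := by
  unfold sgnT
  by_cases h : b.2 ∈ T
  · rw [if_neg (by simp [Finset.mem_symmDiff, h]), if_pos h, neg_neg]
  · rw [if_pos (by simp [Finset.mem_symmDiff, h]), if_neg h]

/-- in `ℤ∕(2Sn)`: `2·(Sn − 1) + 2 = 0`. [folklore] -/
theorem two_mul_natCast_pred_add_two (hM : ∀ ν, M ν = 2 * S) (μ : Fin (d + 1)) :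
    (2 : ZMod (fine n M μ)) * ((S * n - 1 : ℕ) : ZMod (fine n M μ)) + 2 = 0 := by
  have hS : 1 ≤ S := by
    have := NeZero.ne (M μ); rw [hM μ] at this; omega
  have hn : 1 ≤ n := Nat.one_le_iff_ne_zero.mpr (NeZero.ne n)
  have hSn : 1 ≤ S * n := Nat.one_le_iff_ne_zero.mpr (Nat.mul_ne_zero (by omega) (by omega))
  have hcast : ((2 * (S * n - 1) + 2 : ℕ) : ZMod (fine n M μ)) = 0 := by
    have h2 : 2 * (S * n - 1) + 2 = n * M μ := by
      rw [hM μ]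
      generalize hN : S * n = N at hSn
      have : n * (2 * S) = 2 * N := by rw [← hN]; ring
      omega
    rw [h2]
    exact ZMod.natCast_self (n * M μ)
  have : ((2 * (S * n - 1) + 2 : ℕ) : ZMod (fine n M μ)) = 2 * ((S * n - 1 : ℕ) : ZMod (fine n M μ)) + 2 := by
    generalize S * n - 1 = t
    push_cast
    ring
  rw [← this, hcast]

/-- ★ **SEAM BONDS ARE THEIR OWN MIRROR IMAGES**: if the `T`-image of `b` is a seam bond, the `T △ {μ}`-image of `b` (`μ` the bond's direction) is the SAME bond. [cite: Balaban1984PropagatorsI, (1.1) p.18 (antisymmetry of 1-forms under bond reversal)] -/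
theorem imgBond_symmDiff_of_seam (hM : ∀ ν, M ν = 2 * S) {T : Finset (Fin (d + 1))} {b : Tor (fine n M) × Fin (d + 1)}
    (hseam : ((imgBond M n c T b).1 b.2 - up n M c b.2).val = S * n - 1) :
    imgBond M n c (symmDiff T {b.2}) b = imgBond M n c T b := by
  have hkey := two_mul_natCast_pred_add_two (n := n) hM b.2
  -- the seam coordinate as an equation in `ℤ∕(2Sn)`
  have hE : (imgBond M n c T b).1 b.2 - up n M c b.2 = ((S * n - 1 : ℕ) : ZMod (fine n M b.2)) := by
    rw [← hseam, ZMod.natCast_zmod_val]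
  refine Prod.ext (funext fun ν => ?_) rfl
  by_cases hν : ν = b.2
  · subst hν
    by_cases hT : b.2 ∈ T
    · have hT' : b.2 ∉ symmDiff T {b.2} := by simp [Finset.mem_symmDiff, hT]
      simp only [imgBond, imgPt, if_pos hT, if_neg hT', Pi.sub_apply, sub_zero, unitVec, Pi.single_eq_same] at hE ⊢
      linear_combination (-2 : ZMod (fine n M b.2)) * hE - hkey
    · have hT' : b.2 ∈ symmDiff T {b.2} := by simp [Finset.mem_symmDiff, hT]
      simp only [imgBond, imgPt, if_neg hT, if_pos hT', Pi.sub_apply, sub_zero, unitVec, Pi.single_eq_same] at hE ⊢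
      linear_combination (-2 : ZMod (fine n M b.2)) * hE - hkey
  · have hiff : ν ∈ symmDiff T {b.2} ↔ ν ∈ T := by simp [Finset.mem_symmDiff, hν]
    by_cases hνT : ν ∈ T
    · by_cases hT : b.2 ∈ T
      · have hT' : b.2 ∉ symmDiff T {b.2} := by simp [Finset.mem_symmDiff, hT]
        simp [imgBond, imgPt, hiff, hνT, hT, hT', unitVec, hν]
      · have hT' : b.2 ∈ symmDiff T {b.2} := by simp [Finset.mem_symmDiff, hT]
        simp [imgBond, imgPt, hiff, hνT, hT, hT', unitVec, hν]
    · by_cases hT : b.2 ∈ T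
      · have hT' : b.2 ∉ symmDiff T {b.2} := by simp [Finset.mem_symmDiff, hT]
        simp [imgBond, imgPt, hiff, hνT, hT, hT', unitVec, hν]
      · have hT' : b.2 ∈ symmDiff T {b.2} := by simp [Finset.mem_symmDiff, hT]
        simp [imgBond, imgPt, hiff, hνT, hT, hT', unitVec, hν]

/-- ★★ **THE SOURCE MASK MAY BE THE WHOLE CUBE**: `Sym ∘ M_{χ°} = Sym ∘ M_{χ_□}` — the seam bonds (start in the cube, on the upper mirror of their own direction), where the
interior indicator `χ°` and the cube's block indicator `χ_□` differ, are fixed by the reflection of their own direction, which enters the symmetriser with BOTH signs.  (So the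
Neumann cube propagator's source cut is read through King's unit blocks — compatible with the pairing of two spacings.) [cite: Balaban1984PropagatorsII, (2.37) p.229 (images)] -/
theorem symOp_comp_mulOp_chiInt (hM : ∀ ν, M ν = 2 * S) : symOp M n c ∘ₗ mulOp (chiInt M n c S) = symOp M n c ∘ₗ mulOp (chiCube M n c S) := by
  classical
  refine LinearMap.ext fun f => funext fun b => ?_
  rw [LinearMap.comp_apply, LinearMap.comp_apply, ← sub_eq_zero, ← Pi.sub_apply, ← map_sub, symOp_apply]
  simp only [Pi.sub_apply, mulOp_apply, ← sub_mul]
  -- the involution `T ↦ T △ {μ}` on the subsets of directions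
  refine Finset.sum_involution (fun T _ => symmDiff T {b.2}) (fun T _ => ?_) (fun T _ _ => ?_) (fun T _ => Finset.mem_powerset.mpr (Finset.subset_univ _))
    (fun T _ => symmDiff_symmDiff_cancel_right _ _)
  · -- paired terms cancel: both vanish, or the two images are the same seam bond with opposite signs
    by_cases h1 : chiInt M n c S (imgBond M n c T b) - chiCube M n c S (imgBond M n c T b) = 0
    · by_cases h2 : chiInt M n c S (imgBond M n c (symmDiff T {b.2}) b) - chiCube M n c S (imgBond M n c (symmDiff T {b.2}) b) = 0
      · rw [h1, h2]; ring
      · -- impossible: the toggled image would be a seam bond, hence equal to the `T`-image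
        have hs := (seam_of_chiCube_ne_chiInt (fun h => h2 (by rw [h, sub_self]))).2
        have heq := imgBond_symmDiff_of_seam (c := c) hM (T := symmDiff T {b.2}) hs
        rw [symmDiff_symmDiff_cancel_right] at heq
        rw [heq] at h1
        exact absurd h1 h2
    · have hs := (seam_of_chiCube_ne_chiInt (fun h => h1 (by rw [h, sub_self]))).2
      rw [imgBond_symmDiff_of_seam hM hs, sgnT_symmDiff]
      ring
  · -- the involution has no fixed points
    intro hTT
    have := congrArg (fun U : Finset (Fin (d + 1)) => b.2 ∈ U) hTT
    simp [Finset.mem_symmDiff] at this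

variable (M n c S) (a : ℝ)

/-- ★★ **THE NEUMANN CUBE PROPAGATOR WITH THE BLOCK SOURCE CUT**: `G(□ + c) = Sym ∘ G ∘ M_{χ_□}`. [cite: Balaban1984PropagatorsII, (2.37) p.229] -/
theorem neumannCubeG_eq_chiCube (hM : ∀ ν, M ν = 2 * S) (hn : 1 ≤ n) (ha : 0 < a) :
    neumannCubeG M n c S a = symOp M n c ∘ₗ gOp M n a ∘ₗ mulOp (chiCube M n c S) := by
  rw [neumannCubeG, ← LinearMap.comp_assoc, symOp_comp_gOp M n c a hn ha, LinearMap.comp_assoc, symOp_comp_mulOp_chiInt hM, ← LinearMap.comp_assoc,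
    ← symOp_comp_gOp M n c a hn ha, LinearMap.comp_assoc]

end Seam

/-! ## §15 The block indicator and King's pairing; the η-defect of the cube-localized Neumann propagators, EXACTLY -/

section Assembly

variable {M : Fin (d + 1) → ℕ} [∀ μ, NeZero (M μ)] (L k r : ℕ) [NeZero L] (c : Tor M) (S : ℕ)

/-- `χ_□` is read on King's unit blocks, hence through the pairing: `χ_□(prV b′) = χ′_□(b′)`. [cite: King1986, p.664 (pairing convention)] -/
theorem chiCube_kingPrV (b' : Tor (fine (L ^ r * L ^ k) M) × Fin (d + 1)) : chiCube M (L ^ k) c S (kingPrV L k r M b') = chiCube M (L ^ r * L ^ k) c S b' := by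
  have h : blockOf (L ^ k) M (kingPrV L k r M b').1 = blockOf (L ^ r * L ^ k) M b'.1 := congrFun (blkFine_comp_kingPrV M L k r) b'
  unfold chiCube
  rw [h]

/-- `P ∘ M_{χ_□} = M_{χ′_□} ∘ P`. [folklore] -/
theorem pull_kingPrV_comp_mulOp_chiCube : pull (kingPrV L k r M) ∘ₗ mulOp (chiCube M (L ^ k) c S) = mulOp (chiCube M (L ^ r * L ^ k) c S) ∘ₗ pull (kingPrV L k r M) := by
  refine LinearMap.ext fun f => funext fun b' => ?_
  simp only [LinearMap.comp_apply, pull_apply, mulOp_apply, chiCube_kingPrV]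

/-- `𝔇(M_{χ′_□}, M_{χ_□}) = 0`. [folklore] -/
theorem idef_mulOp_chiCube : idef (pull (kingPrV L k r M)) (pull (kingPrV L k r M)) (mulOp (chiCube M (L ^ r * L ^ k) c S)) (mulOp (chiCube M (L ^ k) c S)) = 0 := by
  rw [idef, pull_kingPrV_comp_mulOp_chiCube, sub_self]

/-- one face term, rearranged for the estimate: `M_{χ′} ∘ (M_{mask} ∘ P ∘ R_T ∘ D) ∘ (G ∘ M_χ) = M_{mask} ∘ P ∘ (M_χ ∘ R_T ∘ (D ∘ G ∘ M_χ))`. [folklore] -/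
theorem faceTerm_eq (T : Finset (Fin (d + 1))) (G D : (Tor (fine (L ^ k) M) × Fin (d + 1) → ℝ) →ₗ[ℝ] (Tor (fine (L ^ k) M) × Fin (d + 1) → ℝ)) :
    mulOp (chiCube M (L ^ r * L ^ k) c S) ∘ₗ (mulOp (faceMask M (L ^ r * L ^ k) (L ^ r) T) ∘ₗ pull (kingPrV L k r M) ∘ₗ reflSet M (L ^ k) c T ∘ₗ D) ∘ₗ
        (G ∘ₗ mulOp (chiCube M (L ^ k) c S)) =
      mulOp (faceMask M (L ^ r * L ^ k) (L ^ r) T) ∘ₗ pull (kingPrV L k r M) ∘ₗ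
        (mulOp (chiCube M (L ^ k) c S) ∘ₗ reflSet M (L ^ k) c T ∘ₗ (D ∘ₗ G ∘ₗ mulOp (chiCube M (L ^ k) c S))) := by
  refine LinearMap.ext fun f => funext fun b' => ?_
  simp only [LinearMap.comp_apply, mulOp_apply, pull_apply, chiCube_kingPrV]
  ring

variable (a : ℝ)

/-- ★★★ **THE η-DEFECT OF THE CUBE-LOCALIZED NEUMANN PROPAGATORS, EXACTLY**: with `G_□ = M_{χ_□} ∘ G(□ + c)` on the coarse torus (`n = L^k`) and `G′_□` its fine twin (`n′ = L^r·L^k`),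
King's prolongation `P = pull prV` on both sides,
`𝔇(G′_□, G_□) = M_{χ′_□} ∘ Sym′ ∘ 𝔇(G′, G) ∘ M_{χ_□} + Σ_T M_{mask_T} ∘ P ∘ (M_{χ_□} ∘ R_T ∘ (D ∘ G ∘ M_{χ_□}))`
— the TORUS two-grid defect `𝔇(G′, G) = G′P − PG` dressed by the images, plus `2^{d+1}` face terms each carrying one own-direction COARSE DIFFERENCE of `G` (an `η`, against the
`η⁻¹`-normalised (1.110) gradient letter).  Mechanism: `Sym ∘ M_{χ°} = Sym ∘ M_{χ_□}` (§14), `P ∘ M_{χ_□} = M_{χ′_□} ∘ P`, `R′_T∘P = P∘R_T + M_{mask_T}∘P∘R_T∘D` (§13), Leibniz for `𝔇`.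
[cite: Balaban1985BackgroundPropagators, Thm 3.14 pp.426–427 (difference template), (3.42) p.397 (shape); Balaban1984PropagatorsII, (2.37) p.229 (Neumann cubes)] -/
theorem idef_chiCube_neumannCubeG (hM : ∀ ν, M ν = 2 * S) (ha : 0 < a) :
    idef (pull (kingPrV L k r M)) (pull (kingPrV L k r M))
        (mulOp (chiCube M (L ^ r * L ^ k) c S) ∘ₗ neumannCubeG M (L ^ r * L ^ k) c S a) (mulOp (chiCube M (L ^ k) c S) ∘ₗ neumannCubeG M (L ^ k) c S a) =
      mulOp (chiCube M (L ^ r * L ^ k) c S) ∘ₗ symOp M (L ^ r * L ^ k) c ∘ₗ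
          idef (pull (kingPrV L k r M)) (pull (kingPrV L k r M)) (gOp M (L ^ r * L ^ k) a) (gOp M (L ^ k) a) ∘ₗ mulOp (chiCube M (L ^ k) c S) +
        ∑ T ∈ (Finset.univ : Finset (Fin (d + 1))).powerset,
          mulOp (faceMask M (L ^ r * L ^ k) (L ^ r) T) ∘ₗ pull (kingPrV L k r M) ∘ₗ
            (mulOp (chiCube M (L ^ k) c S) ∘ₗ reflSet M (L ^ k) c T ∘ₗ (ownDiff M (L ^ k) ∘ₗ gOp M (L ^ k) a ∘ₗ mulOp (chiCube M (L ^ k) c S))) := by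
  have hL0 : 0 < L := Nat.pos_of_ne_zero (NeZero.ne L)
  have hn : 1 ≤ L ^ k := Nat.one_le_pow _ _ hL0
  have hn' : 1 ≤ L ^ r * L ^ k := Nat.one_le_iff_ne_zero.mpr (Nat.mul_ne_zero (pow_ne_zero r (NeZero.ne L)) (by positivity))
  rw [neumannCubeG_eq_chiCube M (L ^ r * L ^ k) c S a hM hn' ha, neumannCubeG_eq_chiCube M (L ^ k) c S a hM hn ha, idef_comp, idef_mulOp_chiCube,
    LinearMap.zero_comp, add_zero, idef_comp, idef_comp, idef_mulOp_chiCube, LinearMap.comp_zero, zero_add, idef_symOp_kingPrV, LinearMap.comp_add,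
    fsum_comp, comp_fsum]
  exact congrArg₂ (· + ·) rfl (Finset.sum_congr rfl fun T _ => faceTerm_eq L k r c S T _ _)

end Assembly

end Summit.QuantumFields.YangMills.BalabanUVNodes.N15.TwoGrid
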